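import Mathlib.AlgebraicGeometry.AffineSpace
import Literature.AlgebraicGeometry.Resolution.ResolutionLocalization

/-!
# Crux `ProductDescent` (stmt-ResolutionOfSingularities-15231), line `birth` — stub
# `stub_genericFibreEmbedding`

The generic fibre of `𝔸ˢ_Y → 𝔸ˢ_{𝔽_p}`. For a scheme `Y` over the prime field `𝔽_p = ZMod p`
and `K = 𝔽_p(t₁, …, t_s) = FractionRing (MvPolynomial (Fin s) (ZMod p))`, the constant-field
extension `Y_K = Y ×_{Spec 𝔽_p} Spec K` maps into `𝔸ˢ_Y` over `Y` by a flat preimmersion `ι`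
whose range contains every point of `𝔸ˢ_Y` lying over the generic point of `𝔸ˢ_{𝔽_p}` (in
particular every point with the same image in `𝔸ˢ_{𝔽_p}` as the generic point of `𝔸ˢ_Y`).

Proof: pullback pasting. The square `𝔸ˢ_Y → 𝔸ˢ_{𝔽_p}` over `Y → Spec 𝔽_p` is cartesian
(`AffineSpace.isPullback_map`), and `Spec K → Spec 𝔽_p` factors through
`g : Spec K → Spec 𝔽_p[t₁, …, t_s] ≅ 𝔸ˢ_{𝔽_p}`, a flat preimmersion (a localization) hitting the
generic point. Hence `Y_K` is the base change of `g` along `𝔸ˢ_Y → 𝔸ˢ_{𝔽_p}`, and `ι` is the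
base change of `g`.
-/

noncomputable section

set_option linter.dupNamespace false

open CategoryTheory CategoryTheory.Limits AlgebraicGeometry Literature.AlgebraicGeometry.Resolution

namespace Summit.ResolutionOfSingularities.ResolutionOfSingularities.Theorems.ProductDescent.Birth

universe u

/-- A continuous surjection from an irreducible quasi-sober space onto an irreducible quasi-sober
`T₀` space maps the generic point to the generic point (private copy of the helper in the sibling
stub file `UniversalCellsProductDescentFibreGenericPoint`). [folklore] -/
private theorem map_genericPoint_eq_of_surjective {α β : Type*} [TopologicalSpace α]
    [TopologicalSpace β] [QuasiSober α] [IrreducibleSpace α] [QuasiSober β] [IrreducibleSpace β]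
    [T0Space β] {f : α → β} (hf : Continuous f) (hsurj : Function.Surjective f) :
    f (genericPoint α) = genericPoint β := by
  have h := (genericPoint_spec α).image hf
  rw [Set.image_univ, hsurj.range_eq, closure_univ] at h
  exact h.eq (genericPoint_spec β)

/-- A surjective morphism of irreducible schemes maps the generic point to the generic point
(private copy of `apply_genericPoint_of_surjective` of the sibling stub file
`UniversalCellsProductDescentFibreGenericPoint`). [folklore] -/
private theorem map_genericPoint_of_surjective {X Z : Scheme.{u}} [IrreducibleSpace X]
    [IrreducibleSpace Z] (f : X ⟶ Z) [Surjective f] :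
    f.base (genericPoint X) = genericPoint Z :=
  map_genericPoint_eq_of_surjective f.continuous f.surjective

/-- **Pullback pasting along `𝔸ⁿ`.** For `f : Y ⟶ T` and a morphism `gs : Z ⟶ T` factoring as
`g ≫ (𝔸ⁿ_T → T)`, the fibre product `Y ×_T Z` maps to `𝔸ⁿ_Y` over `Y`, and the resulting square
over `g` and `𝔸ⁿ_f : 𝔸ⁿ_Y → 𝔸ⁿ_T` is cartesian. [folklore] -/
theorem exists_isPullback_affineSpace_map {n : Type u} {Y T Z : Scheme.{u}} (f : Y ⟶ T)
    (gs : Z ⟶ T) (g : Z ⟶ 𝔸(n; T)) (hg : g ≫ (𝔸(n; T) ↘ T) = gs) :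
    ∃ ι : pullback f gs ⟶ 𝔸(n; Y), ι ≫ (𝔸(n; Y) ↘ Y) = pullback.fst f gs ∧
      IsPullback (pullback.snd f gs) ι g (AffineSpace.map n f) := by
  have H1 := AffineSpace.isPullback_map (n := n) f
  have w : (pullback.snd f gs ≫ g) ≫ (𝔸(n; T) ↘ T) = pullback.fst f gs ≫ f := by
    rw [Category.assoc, hg, pullback.condition]
  refine ⟨H1.lift _ _ w, H1.lift_snd _ _ w, ?_⟩
  refine IsPullback.of_bot ?_ (H1.lift_fst _ _ w).symm H1
  rw [H1.lift_snd, hg]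
  exact (IsPullback.of_hasPullback f gs).flip

/-- **The generic point of `𝔸ⁿ` over a domain `k`.** The morphism
`g : Spec (Frac k[n]) → Spec k[n] ≅ 𝔸ⁿ_k` lies over `Spec (Frac k[n]) → Spec k`, is flat and a
preimmersion (a localization), and its range contains the generic point of `𝔸ⁿ_k`. [folklore] -/
theorem exists_genericPoint_affineSpace (k : Type u) [CommRing k] [IsDomain k] (n : Type u) :
    ∃ g : Spec (.of (FractionRing (MvPolynomial n k))) ⟶ 𝔸(n; Spec (.of k)),
      g ≫ (𝔸(n; Spec (.of k)) ↘ Spec (.of k)) =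
        Spec.map (CommRingCat.ofHom (algebraMap k (FractionRing (MvPolynomial n k)))) ∧
      Flat g ∧ IsPreimmersion g ∧ genericPoint (𝔸(n; Spec (.of k))) ∈ Set.range g.base := by
  haveI : Flat (Spec.map (CommRingCat.ofHom
      (algebraMap (MvPolynomial n k) (FractionRing (MvPolynomial n k))))) := by
    rw [Flat.SpecMap_iff, CommRingCat.hom_ofHom, RingHom.flat_algebraMap_iff]
    exact IsLocalization.flat _ (nonZeroDivisors (MvPolynomial n k))
  haveI : IsPreimmersion (Spec.map (CommRingCat.ofHom
      (algebraMap (MvPolynomial n k) (FractionRing (MvPolynomial n k))))) :=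
    IsPreimmersion.of_isLocalization (nonZeroDivisors (MvPolynomial n k))
  refine ⟨Spec.map (CommRingCat.ofHom
      (algebraMap (MvPolynomial n k) (FractionRing (MvPolynomial n k)))) ≫
      (AffineSpace.SpecIso n (.of k)).inv, ?_, inferInstance, inferInstance, ?_⟩
  · rw [Category.assoc, AffineSpace.SpecIso_inv_over, ← Spec.map_comp, ← CommRingCat.ofHom_comp,
      IsScalarTower.algebraMap_eq k (MvPolynomial n k) (FractionRing (MvPolynomial n k)),
      MvPolynomial.algebraMap_eq]
  · refine ⟨genericPoint _, ?_⟩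
    rw [Scheme.Hom.comp_base, TopCat.comp_app]
    erw [specMap_genericPoint_of_injective
      (IsFractionRing.injective (MvPolynomial n k) (FractionRing (MvPolynomial n k)))]
    exact map_genericPoint_of_surjective _

/-- **The generic fibre of `𝔸ˢ_Y → 𝔸ˢ_{𝔽_p}` is `Y ×_{𝔽_p} Spec 𝔽_p(t₁, …, t_s)`.** The
constant-field extension `Y ×_{𝔽_p} Spec 𝔽_p(t₁, …, t_s)` maps to `𝔸ˢ_Y` over `Y` by a flat
preimmersion whose range contains every point of `𝔸ˢ_Y` with the same image in `𝔸ˢ_{𝔽_p}` as the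
generic point of `𝔸ˢ_Y` (pullback pasting along `AffineSpace.isPullback_map` and
`AffineSpace.SpecIso`; the embedding is a base change of the localization
`Spec 𝔽_p(t) → Spec 𝔽_p[t]`). Registered stub `stub_genericFibreEmbedding` of the line `birth` of
crux stmt-ResolutionOfSingularities-15231. [folklore] -/
theorem stub_genericFibreEmbedding :
    ∀ p : ℕ, p.Prime → ∀ (Y : Scheme.{0}) (f : Y ⟶ Spec (.of (ZMod p))) [IsIntegral Y] (s : ℕ),
      ∃ ι : pullback f (Spec.map (CommRingCat.ofHom (algebraMap (ZMod p)
          (FractionRing (MvPolynomial (Fin s) (ZMod p)))))) ⟶ AffineSpace (Fin s) Y,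
        ι ≫ (CategoryTheory.over (AffineSpace (Fin s) Y) Y) = pullback.fst f _ ∧
        Flat ι ∧ IsPreimmersion ι ∧
        ∀ ξ : ↥(AffineSpace (Fin s) Y),
          (AffineSpace.map (Fin s) f).base ξ =
            (AffineSpace.map (Fin s) f).base (genericPoint (AffineSpace (Fin s) Y)) →
          ξ ∈ Set.range ι.base := by
  intro p hp Y f _ s
  haveI : Fact p.Prime := ⟨hp⟩
  obtain ⟨g, hg, hflat, hpre, z, hz⟩ := exists_genericPoint_affineSpace (ZMod p) (Fin s)
  obtain ⟨ι, hι, HB⟩ := exists_isPullback_affineSpace_map f _ g hg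
  refine ⟨ι, hι, MorphismProperty.of_isPullback (P := @Flat) HB hflat,
    MorphismProperty.of_isPullback (P := @IsPreimmersion) HB hpre, ?_⟩
  -- `𝔸ˢ_f` is surjective (a base change of `f : Y → Spec 𝔽_p`, `Y ≠ ∅`), hence maps the generic
  -- point of `𝔸ˢ_Y` to the generic point of `𝔸ˢ_{𝔽_p}`, which is the image of `η_K` under `g`.
  haveI : Subsingleton ↥(Spec (.of (ZMod p))) :=
    inferInstanceAs (Subsingleton (PrimeSpectrum (ZMod p)))
  haveI : Surjective (AffineSpace.map (Fin s) f) :=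
    MorphismProperty.of_isPullback (P := @Surjective) (AffineSpace.isPullback_map f).flip
      inferInstance
  have ha : (AffineSpace.map (Fin s) f).base (genericPoint (AffineSpace (Fin s) Y)) =
      genericPoint (𝔸(Fin s; Spec (.of (ZMod p)))) :=
    map_genericPoint_of_surjective _
  intro ξ hξ
  obtain ⟨x, -, hx⟩ := Scheme.exists_preimage_of_isPullback HB z ξ (by rw [hz, hξ, ha])
  exact ⟨x, hx⟩

end Summit.ResolutionOfSingularities.ResolutionOfSingularities.Theorems.ProductDescent.Birth

end
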